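import Summits.ValiantsHypothesis.ValiantsHypothesis.Theorems.TwoProducts.RankThreeAffineToricWronskianLayerDet

/-!
# Toric Wronskians of monomials, part 5: the first truncation layer is the TOP (domination at a v-resonance)

Sequel of ✓ `…ToricWronskianLayerDet` (`toricW_layer_coeff`, `toricW_first_layer`): the DOMINATION half of the first truncation layer.
★ `toricW_layer_sub_dom` / ★ `toricW_layer_rest_lt`: the two terms of one column expansion are `ν`-dominated by / strictly `ν`-below
`T′ = Σe_i + (N−1)•v + p`; ★ `toricWLayerMat_zero_dom`: at a v-resonance the all-corner start `det B · X^T` VANISHES (`det B = 0`, two equal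
β-columns), so ★★ `toricW_isDomTop_first_layer`: at a resonance every support point of `W_{J(·,u)}(X^e)` other than `T′` is strictly ν-below `T′`, and
★★★ `toricW_isUniqueTop_first_layer`: when the closed form `u_p·(det(e_{i₀},p) − det(e_{j₀},p))·det Vandermonde(β⁺)` of ✓ `toricW_first_layer` is non-zero
(no merge, no second resonant pair), `T′` is the UNIQUE ν-top of `W` and `ν` is NOT an edge direction of `W`.  CONSEQUENCE (the located depth-1 cell of
(TW-flag)): inside the normal cone of a vertex `v` of `Newt u` carrying exactly one resonant pair and no merge, the edge directions of `W` are among the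
directions in which the SECOND point of `supp u` is not unique — pair directions of `supp u`; NEW edge directions need depth ≥ 2 (multiple resonances /
merges), which stays OPEN.  Numerics: scratch `w20.py` (280/280, val-port-4 g5).  HONEST LABEL: located cell on the OPEN rung 3-AFF (side ladder, crux
`stmt-ValiantsHypothesis-5906` `TwoProducts`); (TW-flag) at depth ≥ 2, `OLMLaw`, `RankThreeAffineLaw(Exp)`, `TwoProducts`, PCB, `ResidualLawV25` UNMOVED;
0 summit distance; VP ≠ VNP is NOT proved.  `--supports stmt-ValiantsHypothesis-5906 --as helper` (val-port-4 g5; critic of record val-idea-crit-8 g5).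
No defs, no instances, no notation, no named facts. [folklore]
-/

noncomputable section
set_option linter.dupNamespace false

namespace Summit.ValiantsHypothesis.ValiantsHypothesis.Theorems.TwoProducts.RankTwoJacobian

open scoped BigOperators
open MvPolynomial
open Literature.LinearAlgebra.Matrix (wronskianMatrix wronskian wronskianMatrix_apply wronskian_def)

section TowerKernel
open scoped Classical

/-! ### §1 Weight closure under finite sums -/

/-- strict support-weight bounds survive finite sums. [folklore] -/
theorem wt_lt_of_mem_support_sum {ι : Type*} (S : Finset ι) {ν : Fin 2 → ℝ} {g : ι → Poly2} {w : ℝ}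
    (h : ∀ i ∈ S, ∀ s ∈ (g i).support, wt ν s < w) : ∀ s ∈ (∑ i ∈ S, g i).support, wt ν s < w := by
  induction S using Finset.induction_on with
  | empty => intro s hs; rw [Finset.sum_empty] at hs; simp at hs
  | insert a S ha ih =>
    intro s hs
    rw [Finset.sum_insert ha] at hs
    rcases Finset.mem_union.mp (MvPolynomial.support_add hs) with h' | h'
    · exact h a (Finset.mem_insert_self a S) s h'
    · exact ih (fun i hi => h i (Finset.mem_insert_of_mem hi)) s h'

/-! ### §2 The two expansion terms, domination form -/

/-- ★ the SUB-CORNER term of one column expansion is `ν`-dominated by `T′` (domination twin of ✓ `toricW_layer_sub_term`). -/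
theorem toricW_layer_sub_dom {ν : Fin 2 → ℝ} {u : Poly2} {v p : Expo} (hv : IsUniqueTop ν u v) {K : ℕ} (e : Fin K → Expo)
    {m : ℕ} (hm : m + 1 = ∑ i : Fin K, (i : ℕ)) {j : ℕ} (hj : j < K) :
    IsDomTop ν (((toricWLayerMat u v e j).updateCol ⟨j, hj⟩ (toricWSubCol u v p e ⟨j, hj⟩)).det) ((∑ i, e i) + m • v + p) := by
  rw [Matrix.det_apply]
  refine isDomTop_sum _ fun σ _ => ?_
  set jj : Fin K := ⟨j, hj⟩ with hjj
  rcases Nat.eq_zero_or_eq_succ_pred (σ jj : ℕ) with h0 | hs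
  · have hz1 : ∏ i, (toricWLayerMat u v e j).updateCol jj (toricWSubCol u v p e jj) (σ i) i = 0 :=
      Finset.prod_eq_zero (Finset.mem_univ jj) (by rw [Matrix.updateCol_self]; exact (toricWSubCol_zero u v p e jj _ h0).2)
    rw [hz1, smul_zero]; exact isDomTop_zero ν _
  · set k' := (σ jj : ℕ).pred with hk'
    obtain ⟨hvec, hcol⟩ := toricWSubCol_succ u v p e jj (σ jj) hs
    -- dominating points
    set w : Fin K → ℕ := Function.update (fun i => (σ i : ℕ)) jj k' with hw
    set P : Fin K → Expo := fun i => e i + w i • v + Function.update (fun _ => (0 : Expo)) jj p i with hP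
    have hwj : w jj = k' := by rw [hw, Function.update_self]
    have hwi : ∀ i, i ≠ jj → w i = (σ i : ℕ) := fun i hi => by rw [hw, Function.update_of_ne hi]
    have hsum1 : ∑ i ∈ (Finset.univ : Finset (Fin K)).erase jj, (σ i : ℕ) = ∑ i ∈ (Finset.univ : Finset (Fin K)).erase jj, w i :=
      Finset.sum_congr rfl fun i hi => (hwi i (Finset.ne_of_mem_erase hi)).symm
    have hsumσ : ∑ i, (σ i : ℕ) = ∑ i, w i + 1 := by
      rw [← Finset.sum_erase_add _ _ (Finset.mem_univ jj), ← Finset.sum_erase_add _ w (Finset.mem_univ jj), hsum1, hwj, hs]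
      omega
    have hwm : ∑ i, w i = m := by
      have := Equiv.sum_comp σ (fun i : Fin K => (i : ℕ))
      omega
    have hupd : ∑ i, Function.update (fun _ => (0 : Expo)) jj p i = p := by
      rw [Finset.sum_eq_single_of_mem jj (Finset.mem_univ _) fun i _ hi => by rw [Function.update_of_ne hi],
        Function.update_self]
    have hPsum : ∑ i, P i = (∑ i, e i) + m • v + p := by
      rw [hP]
      simp only
      rw [Finset.sum_add_distrib, Finset.sum_add_distrib, ← Finset.sum_smul, hwm, hupd]
    have hPj : P jj = e jj + k' • v + p := by
      rw [hP]; simp only; rw [hwj, Function.update_self]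
    have hPi : ∀ i, i ≠ jj → P i = e i + (σ i : ℕ) • v := fun i hi => by
      rw [hP]; simp only; rw [hwi i hi, Function.update_of_ne hi, add_zero]
    have hdom : ∀ i ∈ (Finset.univ : Finset (Fin K)),
        IsDomTop ν ((toricWLayerMat u v e j).updateCol jj (toricWSubCol u v p e jj) (σ i) i) (P i) := by
      intro i _
      rw [Matrix.updateCol_apply]
      by_cases h : i = jj
      · subst h
        rw [if_pos rfl, hcol, hPj]
        exact isDomTop_monomial ν _ _
      · rw [if_neg h, hPi i h]
        exact (toricWLayerMat_dom hv e j (σ i) i).1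
    obtain ⟨hd, _⟩ := isDomTop_prod Finset.univ hdom
    rw [hPsum] at hd
    exact (isDomTop_units_smul hd _).1

/-- ★ the REST term of one column expansion is strictly `ν`-below `T′` (weight twin of ✓ `toricW_layer_rest_term`). -/
theorem toricW_layer_rest_lt {ν : Fin 2 → ℝ} {u : Poly2} {v p : Expo} (hv : IsUniqueTop ν u v) (hp : p ∈ u.support) (hpv : p ≠ v)
    (hp2 : ∀ s ∈ u.support, s ≠ v → s ≠ p → wt ν s < wt ν p) {K : ℕ} (e : Fin K → Expo)
    {m : ℕ} (hm : m + 1 = ∑ i : Fin K, (i : ℕ)) {j : ℕ} (hj : j < K) :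
    ∀ s ∈ (((toricWLayerMat u v e j).updateCol ⟨j, hj⟩
      (fun k => (⇑(jacDer u))^[(k : ℕ)] (monomial (e ⟨j, hj⟩) (1 : ℂ)) - toricWLayerMat u v e j k ⟨j, hj⟩
        - toricWSubCol u v p e ⟨j, hj⟩ k)).det).support, wt ν s < wt ν ((∑ i, e i) + m • v + p) := by
  rw [Matrix.det_apply]
  refine wt_lt_of_mem_support_sum _ fun σ _ => ?_
  refine fun s hs => ?_
  replace hs := support_units_smul_subset _ _ hs
  revert s
  set jj : Fin K := ⟨j, hj⟩ with hjj
  -- the rest column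
  set rest : Fin K → Poly2 := fun k => (⇑(jacDer u))^[(k : ℕ)] (monomial (e jj) (1 : ℂ)) - toricWLayerMat u v e j k jj
        - toricWSubCol u v p e jj k with hrest
  rcases Nat.eq_zero_or_eq_succ_pred (σ jj : ℕ) with h0 | hs
  · have hz : ∏ i, (toricWLayerMat u v e j).updateCol jj rest (σ i) i = 0 := by
      refine Finset.prod_eq_zero (Finset.mem_univ jj) ?_
      rw [Matrix.updateCol_self, hrest]
      simp only
      rw [(toricWSubCol_zero u v p e jj _ h0).2, sub_zero]
      unfold toricWLayerMat
      rw [Matrix.of_apply, if_neg (lt_irrefl j), h0, Function.iterate_zero_apply, zero_smul, add_zero, pow_zero, sub_self]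
    rw [hz]; intro s hs; simp at hs
  · set k' := (σ jj : ℕ).pred with hk'
    obtain ⟨hvec, hcol⟩ := toricWSubCol_succ u v p e jj (σ jj) hs
    obtain ⟨hsec, hcoef⟩ := toricW_column_second hv hp hpv hp2 (e jj) k'
    -- weights of the rest column in row σ jj: strictly below the sub-corner
    have hrest_lt : ∀ s ∈ (rest (σ jj)).support, wt ν s < wt ν (e jj + k' • v + p) := by
      intro s hs'
      have hsR := MvPolynomial.mem_support_iff.mp hs'
      have hcor : toricWLayerMat u v e j (σ jj) jj = monomial (e jj + (k' + 1) • v) (toricWCornerWt u v e jj ^ (k' + 1)) := by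
        unfold toricWLayerMat; rw [Matrix.of_apply, if_neg (lt_irrefl j), hs]
      have hc : coeff s (rest (σ jj)) = coeff s ((⇑(jacDer u))^[k' + 1] (monomial (e jj) (1 : ℂ)))
          - (if e jj + (k' + 1) • v = s then toricWCornerWt u v e jj ^ (k' + 1) else 0)
          - (if e jj + k' • v + p = s then toricWSubVec u v p e jj (σ jj) else 0) := by
        rw [hrest]; simp only; rw [hcor, hcol, hs, coeff_sub, coeff_sub, coeff_monomial, coeff_monomial]
      have hcorner := (isDomTop_iterate_jacDer hv (e jj) 1 (k' + 1)).2
      rw [one_mul] at hcorner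
      have hne : e jj + (k' + 1) • v ≠ e jj + k' • v + p := by
        intro h
        have h' := congrArg (wt ν) h
        rw [wt_add, wt_add, wt_add, succ_nsmul, wt_add] at h'
        have := hv.2 p hp hpv
        linarith
      by_cases h1 : s = e jj + (k' + 1) • v
      · subst h1
        rw [if_pos rfl, if_neg (Ne.symm hne).symm.symm, sub_zero, hcorner] at hc
        · exact absurd (by rw [hc]; unfold toricWCornerWt; ring) hsR
      · by_cases h2 : s = e jj + k' • v + p
        · subst h2
          rw [if_neg hne, if_pos rfl, sub_zero, hcoef, hvec] at hc
          exact absurd (by rw [hc]; unfold toricWCornerWt; ring) hsR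
        · rw [if_neg (Ne.symm h1), if_neg (Ne.symm h2), sub_zero, sub_zero] at hc
          exact hsec s (MvPolynomial.mem_support_iff.mpr (hc ▸ hsR)) h1 h2
    -- weights of the other factors
    have hothers : ∀ i ∈ (Finset.univ : Finset (Fin K)).erase jj,
        ∀ s ∈ ((toricWLayerMat u v e j).updateCol jj rest (σ i) i).support, wt ν s ≤ wt ν (e i + (σ i : ℕ) • v) := by
      intro i hi
      rw [Matrix.updateCol_apply, if_neg (Finset.ne_of_mem_erase hi)]
      exact (toricWLayerMat_dom hv e j (σ i) i).1.le
    have hprod := wt_le_of_mem_support_prod _ hothers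
    have hsplit : ∏ i, (toricWLayerMat u v e j).updateCol jj rest (σ i) i =
        (∏ i ∈ (Finset.univ : Finset (Fin K)).erase jj, (toricWLayerMat u v e j).updateCol jj rest (σ i) i) *
          (toricWLayerMat u v e j).updateCol jj rest (σ jj) jj :=
      (Finset.prod_erase_mul _ _ (Finset.mem_univ jj)).symm
    rw [hsplit]
    have hjfac : (toricWLayerMat u v e j).updateCol jj rest (σ jj) jj = rest (σ jj) := by rw [Matrix.updateCol_self]
    rw [hjfac]
    have hlt := wt_lt_of_mem_support_mul hprod hrest_lt
    -- the total weight is `wt T′`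
    have hT : (∑ i ∈ (Finset.univ : Finset (Fin K)).erase jj, wt ν (e i + (σ i : ℕ) • v)) + wt ν (e jj + k' • v + p) =
        wt ν ((∑ i, e i) + m • v + p) := by
      set w : Fin K → ℕ := Function.update (fun i => (σ i : ℕ)) jj k' with hw
      have hwj : w jj = k' := by rw [hw, Function.update_self]
      have hwi : ∀ i, i ≠ jj → w i = (σ i : ℕ) := fun i hi => by rw [hw, Function.update_of_ne hi]
      have hsum1 : ∑ i ∈ (Finset.univ : Finset (Fin K)).erase jj, (σ i : ℕ) = ∑ i ∈ (Finset.univ : Finset (Fin K)).erase jj, w i :=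
        Finset.sum_congr rfl fun i hi => (hwi i (Finset.ne_of_mem_erase hi)).symm
      have hsumσ : ∑ i, (σ i : ℕ) = ∑ i, w i + 1 := by
        rw [← Finset.sum_erase_add _ _ (Finset.mem_univ jj), ← Finset.sum_erase_add _ w (Finset.mem_univ jj), hsum1, hwj, hs]
        omega
      have hwm : ∑ i, w i = m := by
        have := Equiv.sum_comp σ (fun i : Fin K => (i : ℕ))
        omega
      have hupd : ∑ i, Function.update (fun _ => (0 : Expo)) jj p i = p := by
        rw [Finset.sum_eq_single_of_mem jj (Finset.mem_univ _) fun i _ hi => by rw [Function.update_of_ne hi],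
          Function.update_self]
      have hPsum : ∑ i, (e i + w i • v + Function.update (fun _ => (0 : Expo)) jj p i) = (∑ i, e i) + m • v + p := by
        rw [Finset.sum_add_distrib, Finset.sum_add_distrib, ← Finset.sum_smul, hwm, hupd]
      rw [← hPsum, wt_finset_sum, ← Finset.sum_erase_add _ _ (Finset.mem_univ jj), hwj, Function.update_self]
      congr 1
      refine Finset.sum_congr rfl fun i hi => ?_
      rw [hwi i (Finset.ne_of_mem_erase hi), Function.update_of_ne (Finset.ne_of_mem_erase hi), add_zero]
    rw [hT] at hlt
    exact hlt


/-! ### §3 The all-corner start vanishes at a resonance, and the induction -/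

/-- at a resonance `β_{i₀} = β_{j₀}` the all-corner matrix has determinant with EMPTY support (it is `det B · X^T` and `det B = 0`), hence is
`ν`-dominated by any point. [folklore] -/
theorem toricWLayerMat_zero_dom (ν : Fin 2 → ℝ) (u : Poly2) (v : Expo) {K : ℕ} (e : Fin K → Expo) {i₀ j₀ : Fin K} (hne : i₀ ≠ j₀)
    (hβ : toricWCornerWt u v e i₀ = toricWCornerWt u v e j₀) (Z : Expo) : IsDomTop ν (toricWLayerMat u v e 0).det Z := by
  -- support ⊆ {T} and the `T`-coefficient is `det B = 0`
  set T : Expo := ∑ i, (e i + (i : ℕ) • v) with hT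
  have hterm : ∀ σ : Equiv.Perm (Fin K), ∏ i, toricWLayerMat u v e 0 (σ i) i =
      monomial T (∏ i, toricWCornerWt u v e i ^ (σ i : ℕ)) := by
    intro σ
    have : ∏ i, toricWLayerMat u v e 0 (σ i) i = monomial (∑ i, (e i + (σ i : ℕ) • v)) (∏ i, toricWCornerWt u v e i ^ (σ i : ℕ)) := by
      rw [← toricW_prod_monomial]
      refine Finset.prod_congr rfl fun i _ => ?_
      unfold toricWLayerMat; rw [Matrix.of_apply, if_neg (Nat.not_lt_zero _)]
    rw [this, hT, Finset.sum_add_distrib, Finset.sum_add_distrib, ← Finset.sum_smul, ← Finset.sum_smul,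
      Equiv.sum_comp σ (fun i : Fin K => (i : ℕ))]
  have hsupp : ∀ s ∈ (toricWLayerMat u v e 0).det.support, s = T := by
    intro s hs
    rw [Matrix.det_apply] at hs
    -- crude route: induction-free, via coefficient
    by_contra hsT
    have hc : coeff s (∑ σ : Equiv.Perm (Fin K), Equiv.Perm.sign σ • ∏ i, toricWLayerMat u v e 0 (σ i) i) = 0 := by
      rw [coeff_sum]
      refine Finset.sum_eq_zero fun σ _ => ?_
      rw [coeff_units_smul, hterm σ, coeff_monomial, if_neg (Ne.symm hsT), smul_zero]
    exact (MvPolynomial.mem_support_iff.mp hs) hc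
  have hcoefT : coeff T (toricWLayerMat u v e 0).det = 0 := by
    rw [Matrix.det_apply, coeff_sum]
    have hB : (toricWBt u v e).det = 0 := by
      refine Matrix.det_zero_of_column_eq hne fun k => ?_
      unfold toricWBt; rw [Matrix.of_apply, Matrix.of_apply, hβ]
    rw [Matrix.det_apply] at hB
    rw [← hB]
    refine Finset.sum_congr rfl fun σ _ => ?_
    rw [coeff_units_smul, hterm σ, coeff_monomial, if_pos rfl]
    rfl
  intro s hs _
  exfalso
  have hsT := hsupp s hs
  rw [hsT] at hs
  exact (MvPolynomial.mem_support_iff.mp hs) hcoefT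

/-- ★★ **DOMINATION:** at a v-resonance `det(e_{i₀},v) = det(e_{j₀},v)` (`i₀ ≠ j₀`), EVERY support point of `W_{J(·,u)}(X^e)` other than
`T′ = Σe_i + (N−1)•v + p` is strictly `ν`-below `T′`. -/
theorem toricW_isDomTop_first_layer {ν : Fin 2 → ℝ} {u : Poly2} {v p : Expo} (hv : IsUniqueTop ν u v) (hp : p ∈ u.support) (hpv : p ≠ v)
    (hp2 : ∀ s ∈ u.support, s ≠ v → s ≠ p → wt ν s < wt ν p) {K : ℕ} (e : Fin K → Expo)
    {m : ℕ} (hm : m + 1 = ∑ i : Fin K, (i : ℕ)) {i₀ j₀ : Fin K} (hne : i₀ ≠ j₀) (hres : idet (e i₀) v = idet (e j₀) v) :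
    IsDomTop ν (wronskian (⇑(jacDer u)) (fun i => monomial (e i) (1 : ℂ))) ((∑ i, e i) + m • v + p) := by
  have hβ : toricWCornerWt u v e i₀ = toricWCornerWt u v e j₀ := by unfold toricWCornerWt; rw [hres]
  have key : ∀ j, j ≤ K → IsDomTop ν (toricWLayerMat u v e j).det ((∑ i, e i) + m • v + p) := by
    intro j
    induction j with
    | zero => intro _; exact toricWLayerMat_zero_dom ν u v e hne hβ _
    | succ j ih =>
      intro hj
      have hjK : j < K := by omega
      have hfull : (fun k : Fin K => (⇑(jacDer u))^[(k : ℕ)] (monomial (e ⟨j, hjK⟩) (1 : ℂ))) =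
          (fun k : Fin K => toricWLayerMat u v e j k ⟨j, hjK⟩) + toricWSubCol u v p e ⟨j, hjK⟩ +
            (fun k : Fin K => (⇑(jacDer u))^[(k : ℕ)] (monomial (e ⟨j, hjK⟩) (1 : ℂ)) - toricWLayerMat u v e j k ⟨j, hjK⟩
              - toricWSubCol u v p e ⟨j, hjK⟩ k) := by
        funext k; simp only [Pi.add_apply]; ring
      rw [toricWLayerMat_succ u v e hjK, hfull, Matrix.det_updateCol_add, Matrix.det_updateCol_add, Matrix.updateCol_eq_self]
      refine isDomTop_add (isDomTop_add (ih (by omega)) (toricW_layer_sub_dom hv e hm hjK)) ?_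
      exact fun s hs _ => toricW_layer_rest_lt hv hp hpv hp2 e hm hjK s hs
  have := key K le_rfl
  rw [toricWLayerMat_top] at this
  rw [wronskian_def]
  exact this

/-- ★★★ **THE NEXT CORNER IS THE TOP:** at a v-resonance, whenever the closed form `u_p·(det(e_{i₀},p) − det(e_{j₀},p))·det Vandermonde(β⁺)` is
non-zero (no merge, no second resonant pair, `p ∈ supp u`), `T′ = Σe_i + (N−1)•v + p` is the UNIQUE `ν`-top of `W_{J(·,u)}(X^e)`; in particular `ν` is
NOT an edge direction of `W`.  So inside the cone of the vertex `v`, at depth 1 the edge directions of `W` are confined to the directions where the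
second point `p(ν)` of `supp u` is not unique or the closed form vanishes. -/
theorem toricW_isUniqueTop_first_layer {ν : Fin 2 → ℝ} {u : Poly2} {v p : Expo} (hv : IsUniqueTop ν u v) (hp : p ∈ u.support) (hpv : p ≠ v)
    (hp2 : ∀ s ∈ u.support, s ≠ v → s ≠ p → wt ν s < wt ν p) {K : ℕ} (e : Fin K → Expo)
    {m : ℕ} (hm : m + 1 = ∑ i : Fin K, (i : ℕ)) {i₀ j₀ : Fin K} (hne : i₀ ≠ j₀) (hres : idet (e i₀) v = idet (e j₀) v)
    (hnz : coeff p u * (((idet (e i₀) p : ℤ) : ℂ) - ((idet (e j₀) p : ℤ) : ℂ)) *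
        (Matrix.vandermonde (Function.update (toricWCornerWt u v e) i₀
          (toricWCornerWt u v e i₀ + coeff v u * ((idet p v : ℤ) : ℂ)))).det ≠ 0) :
    IsUniqueTop ν (wronskian (⇑(jacDer u)) (fun i => monomial (e i) (1 : ℂ))) ((∑ i, e i) + m • v + p) ∧
      ¬ IsEdgeDir ν (wronskian (⇑(jacDer u)) (fun i => monomial (e i) (1 : ℂ))) := by
  have hdom := toricW_isDomTop_first_layer hv hp hpv hp2 e hm hne hres
  have hcoef : coeff ((∑ i, e i) + m • v + p) (wronskian (⇑(jacDer u)) (fun i => monomial (e i) (1 : ℂ))) ≠ 0 := by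
    intro h0
    have h1 := toricW_first_layer hv hp hpv hp2 e hm hne hres
    rw [h0, mul_zero] at h1
    exact hnz h1.symm
  have htop := isUniqueTop_of_isDomTop hdom hcoef
  exact ⟨htop, fun hE => not_tie_of_utop ((isUniqueTop_iff _ _ _).mp htop) ((isEdgeDir_iff_tie _ _).mp hE)⟩

end TowerKernel

end Summit.ValiantsHypothesis.ValiantsHypothesis.Theorems.TwoProducts.RankTwoJacobian

end
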